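import Mathlib
import Summits.ResolutionOfSingularities.ResolutionOfSingularities.Theorems.WeightedInvariantLocalWeightedDropPolyDescentDefs
import Summits.ResolutionOfSingularities.ResolutionOfSingularities.Theorems.WeightedInvariantLocalWeightedDropWildMonicKangarooForms

/-!
# `WeightedInvariant.LocalWeightedDrop`, stub S3ρ, line «monic polyhedron descent», piece (ρ-M) part 1: `w`-INITIAL FORMS of a monic
# tuple and of its re-centring at the critical level (the case `d!·ord_w ψ = m`)

Crux item stmt-ResolutionOfSingularities-8899 `LocalWeightedDrop` (route `ResolutionOfSingularities/WeightedInvariant`), engine of the door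
`HypersurfaceCentreConstruction` stmt-ResolutionOfSingularities-19897.  [OURS · L1 W4.3, chain w43; hand res-type-013 on res-L1-w43-plan-1's
DEALS gen 9 #7 (ρ-M) for the line lead res-L1-w43-lead-1 (`L/res-L1-w43-lead-1/g3/poly_descent_line_v1.lean`, stub `PolyDescent.stub_polyMinimality`).
MODEL: H. Hironaka, *Characteristic polyhedra of singularities*, J. Math. Kyoto Univ. 7 (1967) (the well-prepared polygon is the
characteristic polygon), as used in Cossart–Jannsen–Saito LNM 2270 Ch. 8; every object here is OURS — the tuple `B` of `y^d + Σ B_j y^j`,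
res-type-083's `WildMonic.shift`, stub-7's `WildMonic.newtonSet/slotWeight`, `WildMonic.wMin/slotWOrd`, res-type-056's `WildMonic.weight_smul`
(`…WildMonicKangarooForms`) — nothing is a statement of any manuscript.]

For a positive weight `w` on `k⟦x₁,x₂⟧`, a tuple `B` with `m := wMin w B` (the least `w`-weight of the `d!`-scaled Newton set) and a re-centring
`ψ` with `d! · ord_w ψ = m` (so `m = d!·ν`, `ν = ord_w ψ ∈ ℕ`), the `w`-INITIAL FORMS are `F_i := in_{ν(d−i)}(B_i)` (Mathlib's
`MvPowerSeries.weightedHomogeneousComponent`) and `c := in_ν(ψ)`: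
* `wMin_le_weight_of_mem_newtonSet`, `exists_mem_newtonSet_weight_le` — the scaled Newton set and `wMin/slotWOrd` say the same thing;
* `weightedHomogeneousComponent_pow_eq` — `in_{nν}(ψ^n) = c^n`;
* **`weightedHomogeneousComponent_shift`** — `in_{ν(d−j)}((shift d B ψ)_j) = (shift d F c)_j`: at the critical level the re-centred tuple
  is the TAYLOR SHIFT OF THE INITIAL FORMS (both sides are `Σ_{i≥j} C(i,j) F_i c^{i−j}`, `F_d = 1`);
* `exists_extreme_coeff` / `coeff_pow_extreme` / `eq_smul_of_coeff_pow_ne_zero` — for a `w`-homogeneous `c ≠ 0`, the monomial `μ x^a` of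
  `c` with least `x₂`-exponent is EXTREME: `coeff_{n·a}(c^n) = μ^n`, every exponent of `c^n` has `x₂`-exponent `≥ n·a₂`, and the one with
  `x₂`-exponent `n·a₂` IS `n·a` (homogeneity pins `x₁`).
Part 2 (`…PolyDescentMinimality`) turns «every slot of the shift lost the level `m`» into `F_i = C(d,i)(−c)^{d−i}` (Taylor inversion) and
a SOLVABLE INTEGRAL VERTEX `d!·a` of `B`, contradicting well-preparedness.
-/

set_option linter.dupNamespace false -- mandated namespace of this single-conjunct summit

noncomputable section

namespace Summit.ResolutionOfSingularities.ResolutionOfSingularities.Theorems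

namespace PolyDescent

open MvPowerSeries MonicDescent WildMonic

variable {k : Type} [Field k]

/-! ## The scaled Newton set versus `wMin` / `slotWOrd` -/

section Newton

variable (w : Fin 2 → ℕ) {d : ℕ} (A : Fin d → MvPowerSeries (Fin 2) k)

/-- `m = wMin w A` is a lower bound for the `w`-weight of every point of the scaled Newton set (res-type-056's
`WildMonic.slotWOrd_le_weight_smul` one slot up). [OURS · (ρ-M)] -/
theorem wMin_le_weight_of_mem_newtonSet {P : Fin 2 →₀ ℕ} (hP : P ∈ newtonSet A) :
    wMin w A ≤ ((Finsupp.weight w P : ℕ) : ℕ∞) := by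
  obtain ⟨j, e, he, rfl⟩ := hP
  exact le_trans (wMin_le_slotWOrd w A j) (slotWOrd_le_weight_smul w A he)

/-- A point of the scaled Newton set makes `wMin` finite. [folklore] -/
theorem wMin_ne_top_of_mem_newtonSet {P : Fin 2 →₀ ℕ} (hP : P ∈ newtonSet A) : wMin w A ≠ ⊤ :=
  ne_top_of_le_ne_top (ENat.coe_ne_top _) (wMin_le_weight_of_mem_newtonSet w A hP)

/-- A slot of scaled order `≤ m < ⊤` exhibits a point of the scaled Newton set of weight `≤ m`. [OURS · (ρ-M)] -/
theorem exists_mem_newtonSet_weight_le {m : ℕ∞} (hm : m ≠ ⊤) (j : Fin d) (hj : slotWOrd w A j ≤ m) :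
    ∃ Q ∈ newtonSet A, ((Finsupp.weight w Q : ℕ) : ℕ∞) ≤ m := by
  have hfin : (A j).weightedOrder w ≠ ⊤ := by
    refine weightedOrder_ne_top_of_slotWOrd_ne_top w A (i := j) fun h => hm ?_
    rw [h] at hj
    exact top_le_iff.mp hj
  obtain ⟨e, he, hwe⟩ := (A j).exists_coeff_ne_zero_and_weightedOrder w (ENat.coe_toNat hfin)
  refine ⟨slotWeight d j • e, ⟨j, e, he, rfl⟩, le_trans (le_of_eq ?_) hj⟩
  unfold slotWOrd
  rw [weight_smul, Nat.cast_mul, hwe]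

end Newton

/-! ## Exponents on a line of constant weight -/

section Line

variable (w : Fin 2 → ℕ)

/-- On a line `w·e = const` with `w₀ > 0` the `x₂`-exponent determines the point. [folklore] -/
theorem finsupp_eq_of_weight_eq (hw : 0 < w 0) {e e' : Fin 2 →₀ ℕ} (hwt : Finsupp.weight w e = Finsupp.weight w e')
    (h1 : e 1 = e' 1) : e = e' := by
  rw [weight_fin_two, weight_fin_two, h1] at hwt
  have h0 : e 0 = e' 0 := Nat.eq_of_mul_eq_mul_left hw (by omega)
  exact Literature.RingTheory.TwoVariableSeries.finsupp_fin2_ext h0 h1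

/-- `1` is `w`-homogeneous of weight `0`. [folklore] -/
theorem isWeightedHomogeneous_one : IsWeightedHomogeneous w (1 : MvPowerSeries (Fin 2) k) 0 := by
  intro e he
  rw [coeff_one] at he
  split_ifs at he with h0
  · rw [h0, map_zero]
  · exact absurd rfl he

/-- Powers of a `w`-homogeneous series are `w`-homogeneous. [folklore] -/
theorem isWeightedHomogeneous_pow {c : MvPowerSeries (Fin 2) k} {ν : ℕ} (hc : IsWeightedHomogeneous w c ν) (n : ℕ) :
    IsWeightedHomogeneous w (c ^ n) (n * ν) := by
  induction n with
  | zero => rw [pow_zero, zero_mul]; exact isWeightedHomogeneous_one w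
  | succ n ih => rw [pow_succ, Nat.succ_mul]; exact ih.mul hc

/-- A non-zero series has an exponent with non-zero coefficient and LEAST `x₂`-exponent. [folklore] -/
theorem exists_extreme_coeff {c : MvPowerSeries (Fin 2) k} (hc : c ≠ 0) :
    ∃ a : Fin 2 →₀ ℕ, coeff a c ≠ 0 ∧ ∀ e, coeff e c ≠ 0 → a 1 ≤ e 1 := by
  classical
  have hex : ∃ n, ∃ e : Fin 2 →₀ ℕ, coeff e c ≠ 0 ∧ e 1 = n := by
    by_contra hnone
    push Not at hnone
    apply hc
    ext e
    by_contra hne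
    exact hnone (e 1) e hne rfl
  obtain ⟨a, ha, ha1⟩ := Nat.find_spec hex
  exact ⟨a, ha, fun e he => ha1 ▸ Nat.find_min' hex ⟨e, he, rfl⟩⟩

/-- THE EXTREME MONOMIAL OF A HOMOGENEOUS SERIES IS EXTREME IN ITS POWERS: if `c` is `w`-homogeneous (`w₀ > 0`) and `a` is an
exponent of `c` with least `x₂`-exponent, then `coeff_{n·a}(c^n) = (coeff_a c)^n` and every exponent of `c^n` has `x₂`-exponent
`≥ n·a₂`. [folklore] -/
theorem coeff_pow_extreme (hw : 0 < w 0) {c : MvPowerSeries (Fin 2) k} {ν : ℕ} (hhom : IsWeightedHomogeneous w c ν)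
    {a : Fin 2 →₀ ℕ} (ha : coeff a c ≠ 0) (hmin : ∀ e, coeff e c ≠ 0 → a 1 ≤ e 1) (n : ℕ) :
    coeff (n • a) (c ^ n) = (coeff a c) ^ n ∧ ∀ e, coeff e (c ^ n) ≠ 0 → n * a 1 ≤ e 1 := by
  classical
  induction n with
  | zero =>
    refine ⟨by rw [zero_smul, pow_zero, pow_zero, coeff_one, if_pos rfl], fun e _ => by rw [zero_mul]; exact Nat.zero_le _⟩
  | succ n ih =>
    obtain ⟨ihc, ihmin⟩ := ih
    refine ⟨?_, fun e he => ?_⟩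
    · rw [pow_succ, coeff_mul, Finset.sum_eq_single (n • a, a)]
      · rw [ihc, pow_succ]
      · rintro ⟨e₁, e₂⟩ hmem hne
        rw [Finset.HasAntidiagonal.mem_antidiagonal] at hmem
        by_contra hprod
        have h1 : coeff e₁ (c ^ n) ≠ 0 := left_ne_zero_of_mul hprod
        have h2 : coeff e₂ c ≠ 0 := right_ne_zero_of_mul hprod
        have hsum : e₁ 1 + e₂ 1 = n * a 1 + a 1 := by
          have := congrArg (fun f : Fin 2 →₀ ℕ => f 1) hmem
          simpa [Finsupp.add_apply, succ_nsmul] using this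
        have he₁ : e₁ 1 = n * a 1 := by have := ihmin e₁ h1; have := hmin e₂ h2; omega
        have he₂ : e₂ 1 = a 1 := by have := ihmin e₁ h1; have := hmin e₂ h2; omega
        apply hne
        have hE₂ : e₂ = a := finsupp_eq_of_weight_eq w hw (by rw [hhom h2, hhom ha]) he₂
        have hE₁ : e₁ = n • a :=
          finsupp_eq_of_weight_eq w hw (by rw [isWeightedHomogeneous_pow w hhom n h1, weight_smul, hhom ha])
            (by rw [he₁, Finsupp.smul_apply, smul_eq_mul])
        rw [hE₁, hE₂]
      · intro hnot
        exact absurd (Finset.HasAntidiagonal.mem_antidiagonal.mpr (succ_nsmul a n).symm) hnot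
    · rw [pow_succ, coeff_mul] at he
      obtain ⟨⟨e₁, e₂⟩, hmem, hne⟩ := Finset.exists_ne_zero_of_sum_ne_zero he
      rw [Finset.HasAntidiagonal.mem_antidiagonal] at hmem
      dsimp only at hmem hne
      have h1 : coeff e₁ (c ^ n) ≠ 0 := left_ne_zero_of_mul hne
      have h2 : coeff e₂ c ≠ 0 := right_ne_zero_of_mul hne
      have := ihmin e₁ h1
      have := hmin e₂ h2
      rw [← hmem, Finsupp.add_apply, Nat.succ_mul]
      omega

/-- … and the exponent of `c^n` with `x₂`-exponent exactly `n·a₂` is `n·a`. [folklore] -/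
theorem eq_smul_of_coeff_pow_ne_zero (hw : 0 < w 0) {c : MvPowerSeries (Fin 2) k} {ν : ℕ} (hhom : IsWeightedHomogeneous w c ν)
    {a : Fin 2 →₀ ℕ} (ha : coeff a c ≠ 0) (n : ℕ) {e : Fin 2 →₀ ℕ} (he : coeff e (c ^ n) ≠ 0) (he1 : e 1 = n * a 1) :
    e = n • a :=
  finsupp_eq_of_weight_eq w hw (by rw [isWeightedHomogeneous_pow w hhom n he, weight_smul, hhom ha])
    (by rw [he1, Finsupp.smul_apply, smul_eq_mul])

end Line

/-! ## Initial forms at the critical level -/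

section Forms

variable (w : Fin 2 → ℕ) {d : ℕ} (B : Fin d → MvPowerSeries (Fin 2) k) (ψ : MvPowerSeries (Fin 2) k) (ν : ℕ)

/-- `in_0(1) = 1`. [folklore] -/
theorem weightedHomogeneousComponent_zero_one :
    weightedHomogeneousComponent w 0 (1 : MvPowerSeries (Fin 2) k) = 1 := by
  ext e
  rw [coeff_weightedHomogeneousComponent, coeff_one]
  split_ifs with h1 h2 h2
  · rfl
  · rfl
  · exact absurd (by rw [h2, map_zero]) h1
  · rfl

/-- A natural-number multiple passes through the component. [folklore] -/
theorem weightedHomogeneousComponent_natCast_mul (p n : ℕ) (f : MvPowerSeries (Fin 2) k) :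
    weightedHomogeneousComponent w p ((n : MvPowerSeries (Fin 2) k) * f) = (n : MvPowerSeries (Fin 2) k) *
      weightedHomogeneousComponent w p f := by
  rw [← nsmul_eq_mul, map_nsmul, nsmul_eq_mul]

/-- **`in_{nν}(ψ^n) = in_ν(ψ)^n`** when `ν ≤ ord_w ψ`. [folklore] -/
theorem weightedHomogeneousComponent_pow_eq (hν : (ν : ℕ∞) ≤ ψ.weightedOrder w) (n : ℕ) :
    weightedHomogeneousComponent w (n * ν) (ψ ^ n) = (weightedHomogeneousComponent w ν ψ) ^ n := by
  induction n with
  | zero => rw [zero_mul, pow_zero, pow_zero, weightedHomogeneousComponent_zero_one]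
  | succ n ih =>
    rw [pow_succ, pow_succ, Nat.succ_mul, weightedHomogeneousComponent_mul_of_le_weightedOrder ?_ hν, ih]
    rw [weightedOrder_pow_eq, Nat.cast_mul]
    gcongr

/-- From `m = d!·ν`: every slot has `ord_w B_i ≥ ν(d − i)`. [OURS · (ρ-M)] -/
theorem le_weightedOrder_of_wMin_eq (hm : wMin w B = (d.factorial : ℕ∞) * ν) (i : Fin d) :
    ((ν * (d - (i : ℕ)) : ℕ) : ℕ∞) ≤ (B i).weightedOrder w := by
  have h := wMin_le_slotWOrd w B i
  rw [hm] at h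
  unfold slotWOrd at h
  have hsw : (d.factorial : ℕ∞) * ν = (slotWeight d i : ℕ∞) * ((ν * (d - (i : ℕ)) : ℕ) : ℕ∞) := by
    rw [← Nat.cast_mul, ← Nat.cast_mul, ← slotWeight_mul_sub i]
    push_cast
    ring
  rw [hsw] at h
  exact (ENat.mul_le_mul_left_iff (by exact_mod_cast (slotWeight_pos i).ne') (ENat.coe_ne_top _)).mp h

/-- **THE RE-CENTRED TUPLE AT THE CRITICAL LEVEL IS THE TAYLOR SHIFT OF THE INITIAL FORMS**: with `F_i = in_{ν(d−i)}(B_i)`,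
`c = in_ν(ψ)`, `ν = ord_w ψ` and `ord_w B_i ≥ ν(d−i)` for all `i`:  `in_{ν(d−j)}((shift d B ψ)_j) = (shift d F c)_j`.
[OURS · (ρ-M); Hironaka 1967 §3 (initial forms under a change of the distinguished variable)] -/
theorem weightedHomogeneousComponent_shift (hν : ψ.weightedOrder w = ν)
    (hB : ∀ i : Fin d, ((ν * (d - (i : ℕ)) : ℕ) : ℕ∞) ≤ (B i).weightedOrder w) (j : Fin d) :
    weightedHomogeneousComponent w (ν * (d - (j : ℕ))) (shift d B ψ j) =
      shift d (fun i => weightedHomogeneousComponent w (ν * (d - (i : ℕ))) (B i)) (weightedHomogeneousComponent w ν ψ) j := by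
  have hν' : (ν : ℕ∞) ≤ ψ.weightedOrder w := hν.ge
  rw [shift_eq, shift_eq, map_add, map_sum]
  congr 1
  · rw [weightedHomogeneousComponent_natCast_mul, mul_comm ν, weightedHomogeneousComponent_pow_eq w ψ ν hν']
  · refine Finset.sum_congr rfl fun i _ => ?_
    by_cases hij : (j : ℕ) ≤ i
    · have hsplit : ν * (d - (j : ℕ)) = ν * (d - (i : ℕ)) + ((i : ℕ) - j) * ν := by
        have hi := i.2
        rw [show d - (j : ℕ) = (d - (i : ℕ)) + ((i : ℕ) - j) by omega, Nat.mul_add, Nat.mul_comm ν ((i : ℕ) - j)]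
      rw [hsplit, weightedHomogeneousComponent_mul_of_le_weightedOrder ?_ ?_, weightedHomogeneousComponent_natCast_mul,
        weightedHomogeneousComponent_pow_eq w ψ ν hν']
      · exact le_trans (hB i) (weightedOrder_le_natCast_mul w _ _)
      · rw [weightedOrder_pow_eq, Nat.cast_mul]
        gcongr
    · have h0 : (i : ℕ).choose j = 0 := Nat.choose_eq_zero_of_lt (by omega)
      rw [h0, Nat.cast_zero, zero_mul, zero_mul, zero_mul, zero_mul, map_zero]

end Forms

end PolyDescent

end Summit.ResolutionOfSingularities.ResolutionOfSingularities.Theorems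

end
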